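import Literature.AlgebraicGeometry.HodgeTheory.CartierDivisorLineBundleHomPullback
import Literature.AlgebraicGeometry.Motives.AbelianVarietyPicZeroOfAmple
import HarnessLib

/-!
# `D^Θ_{e′ x} ∼ e^* D^Θ_x` for a pair of endomorphisms ADJOINT for the Néron–Severi form of `Θ`
# ([Lange 2023] §1.4.2 Lemma 1.4.5, §2.4.1 Prop. 2.4.2 (a), §2.4.5 Exercise (12)(d); [Mumford AV] §20 (3), §23)

Layer `Literature/AlgebraicGeometry/HodgeTheory`, namespace `Literature.AlgebraicGeometry.HodgeTheory`.  THEOREMS ONLY (no definition, no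
named fact, no instance, no `sorry`).  Cell `hodgecm-mathlib` (D-0151), P6 «MOD programme», crux hLiu418 (`stmt-HodgeConjecture-24832`,
`--supports`, count-neutral), E-line `Cruxes/HLiu418/Lines/F0_P6a_PELWitnessE.lean`, organ **E6-R** «Rosati of the fibre endomorphisms at a
marked complex point» (LEAD F0P6-plan (g2) 2026-09-01T22:33:07Z; A-p04 (g23) CENSUS-E6R 28f566deafbc73d3, step (R1)): the ANALYTIC HALF of the
Rosati identity `e′ ≫ λ = λ ≫ e^∨` for the polarisation `λ = Λ(𝒪(Θ))`.  HC_CM is proved only modulo the 2 remaining named inputs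
(hLiu418 24832, h413 24833) until rung 0 closes; nothing here is about HC.

THE MATHEMATICS.  Let `A` be a complex abelian variety uniformised by `φ : X = V/Φ(ℤ^ι) → A(ℂ)` (an analytification compatible with the
group laws), `Θ` a Cartier divisor on `A` with Appell–Humbert datum `p` (`⟦a_p⟧ = [𝒪(Θ)^an]`, Néron–Severi form `E = p.form`), and `e, e′`
endomorphisms of `A` with rational representations `M, M′ ∈ M_ι(ℤ)` (the torus maps `mapMatrix M`, `mapMatrix M′` cover `e`, `e′` through `φ`)
and `ℂ`-linear analytic representations `F, F′`.  If `E(F′u, w) = E(u, F w)` for all `u, w ∈ V` — `e′` is the ADJOINT of `e` for `E`, i.e.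
`e′ = e†` is the Rosati dual of `e` for `φ_Θ` ([Lange2023AbelianVarietiesComplex] Prop. 2.4.2 (a): «`E(ρ_r(f)(λ), μ) = E(λ, ρ_r(f′)(μ))`»;
[MumfordAV1970] §23: «`e^L(γx, y) = e^L(x, γ′y)`») — then for every complex point `x` of `A` the Weil divisor `D^Θ_{e′x} = t_{e′x}^*Θ − Θ`
(★ `AbelianVariety.weilDiv`, the divisor of `φ_Θ(e′x)`, [MumfordAV1970] §8) is LINEARLY EQUIVALENT to the pull-back `e^*D^Θ_x` — the
divisor-level content of `φ_Θ(e′ x) = e^*(φ_Θ(x)) = ê(φ_Θ(x))`, i.e. of `φ_Θ ∘ e′ = ê ∘ φ_Θ` ([MumfordAV1970] §20 (3) «`e_n(f(x), ŷ) =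
e_n(x, f̂(ŷ))`» with `φ_{f^*L} = f̂ φ_L f`).  PROOF: in `Pic(X)` the classes are `φ_L(M′ t̄)` and `(M·)^*φ_L(t̄)` for `L = [𝒪(Θ)^an]`, `φ(t̄) = x`
(★ `picClass_cartierDivisorLineBundle_weilDiv`, ★ `picClass_cartierDivisorLineBundle_pullback_hom`); they agree by ★
`ComplexTorus.Pic.phiL_mapMatrix_eq_pullback_phiL` ([Lange2023AbelianVarietiesComplex] §2.4.5 Exercise (12)(d) / Lemma 1.4.5, at `f₂ = 1_X`);
GAGA injectivity on `Pic` (★ `AbelianVariety.linEquiv_of_picClass_eq`) turns equal classes into linear equivalence.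

* `phiL_toPic_mapMatrix_eq_pullback_phiL_of_form_adjoint` — the torus identity `φ_L(g t̄) = f^*(φ_L t̄)` (Exercise (12)(d) at `f₂ = 1_X`);
* `weilDiv_map_linEquiv_pullback_weilDiv_of_form_adjoint` — the head, for every `x ∈ A(ℂ)`;
* `weilDiv_map_linEquiv_pullback_weilDiv_of_form_adjoint'` — the same at `x = φ t̄`, torus-indexed.

## References
* [Lange2023AbelianVarietiesComplex] H. Lange, *Abelian Varieties over the Complex Numbers* (2023), §1.4.2 Lemma 1.4.5 (p. 44), §2.4.1
  Prop. 2.4.2 (a) (p. 114), §2.4.5 Exercise (12)(d) (p. 126), §1.3.3 Lemma 1.3.6 (p. 31).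
* [MumfordAV1970] D. Mumford, *Abelian Varieties* (1970), §8 (definition of `φ_L`), §20 p. 186 property (3), §23 p. 208.
-/

set_option autoImplicit false

noncomputable section

open Set Function AlgebraicGeometry CategoryTheory
open scoped Manifold ContDiff Topology Matrix
open Literature.AlgebraicGeometry.Motives Literature.Geometry.Kaehler Literature.Geometry.Kaehler.ComplexTorus
open Literature.NumberTheory.Transcendental

namespace Literature.AlgebraicGeometry.HodgeTheory

variable {ι : Type} [Fintype ι] [DecidableEq ι] {A : AbelianVariety ℂ} {Φ : (ι → ℝ) ≃L[ℝ] (Fin A.dim → ℂ)}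
  {φ : ComplexTorus Φ → ComplexPoints A.X} (hφ : IsAnalytification (Fin A.dim → ℂ) A.X A.dim φ)
  (hadd : ∀ x y, φ (x + y) = φ x * φ y)

/-- **[Lange 2023, §2.4.5 Exercise (12)(d) at `f₂ = 1_X` / Lemma 1.4.5] `φ_L(g t̄) = f^*(φ_L(t̄))` in `Pic(X)`** for torus endomorphisms
`g = mapMatrix M′`, `f = mapMatrix M` with `ℂ`-linear analytic representations `F′`, `F` ADJOINT for the form `E = p.form` of `L = ⟦a_p⟧`
(`E(F′u, w) = E(u, F w)`): through (1.13) (`X̂ ≅ Pic⁰(X)`, `f̂ = f^*` on `Pic⁰`, ★ `Pic.pullback_dualToPic`) and Lemma 1.4.5 (★ `AHData.phiL_toPic_cover`: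
`φ_L(π u) = [φ_H(u)]`) both sides are the class of the antidual vector `w ↦ H(F′u, w) = H(u, F w)`.  (The identity ★
`ComplexTorus.Pic.phiL_mapMatrix_eq_pullback_phiL` of `Geometry/Kaehler/ComplexTorusPicardEndomorphismPairing`, re-derived here at `f₂ = 1_X`
from its ★ ingredients to keep this file's import cone inside the served build.)
[cite: Lange2023AbelianVarietiesComplex, §2.4.5 Exercise (12)(d) p. 126, §1.4.2 Lemma 1.4.5 p. 44, §1.4.1 (1.13) p. 43] -/
theorem phiL_toPic_mapMatrix_eq_pullback_phiL_of_form_adjoint {E : Type} [NormedAddCommGroup E] [NormedSpace ℂ E]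
    [FiniteDimensional ℂ E] (Ψ : (ι → ℝ) ≃L[ℝ] E) {M M' : Matrix ι ι ℤ} {F F' : E →L[ℂ] E}
    (hF : ∀ x, Ψ ((M.map (Int.cast : ℤ → ℝ)) *ᵥ x) = F (Ψ x)) (hF' : ∀ x, Ψ ((M'.map (Int.cast : ℤ → ℝ)) *ᵥ x) = F' (Ψ x))
    (p : AHData Ψ) (hadj : ∀ u w : E, p.form ![F' u, w] = p.form ![u, F w]) (t : ComplexTorus Ψ) :
    Pic.phiL (AHData.toPic p) (mapMatrix Ψ Ψ M' t) = Pic.pullback Ψ Ψ hF (Pic.phiL (AHData.toPic p) t) := by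
  rw [← cover_apply_lift t]
  generalize Ψ (ComplexTorus.lift Ψ t) = u
  rw [← cover_apply_analyticRep Ψ Ψ hF', AHData.phiL_toPic_cover, AHData.phiL_toPic_cover, Pic.pullback_dualToPic,
    ← cover_apply_analyticRep (dualPeriod Ψ) (dualPeriod Ψ) (dualPeriod_transpose_mulVec Ψ Ψ F hF)]
  congr 2
  ext w
  rw [antidualPrecomp_apply]
  simp only [phiHFun, antidualOfIm_apply, twoFormLeft_apply, hadj, map_smul]

include hadd

/-- **`D^Θ_{e′(φ t̄)} ∼ e^* D^Θ_{φ t̄}` for `E`-adjoint endomorphisms `e, e′`** (torus-indexed form).  Data: a uniformisation `φ` of `A`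
compatible with the group laws, endomorphisms `e, e′ : A ⟶ A` (`e` dominant, so that `e^*` of a Cartier divisor is defined) covered through
`φ` by the torus maps of integer matrices `M, M′` (`hM`, `hM′`) with `ℂ`-linear analytic representations `F, F′` (`hF`, `hF′`), an Appell–Humbert
datum `p` of `[𝒪(Θ)^an]` (`hp`), and the ADJOINTNESS `E(F′u, w) = E(u, F w)` of the analytic representations for the Néron–Severi form
`E = p.form` ([Lange2023AbelianVarietiesComplex] Prop. 2.4.2 (a)).  Conclusion: `(t_{e′(φ t̄)}^*Θ − Θ) ∼ e^*(t_{φ t̄}^*Θ − Θ)`.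
[cite: Lange2023AbelianVarietiesComplex, §2.4.5 Exercise (12)(d) p. 126, §1.4.2 Lemma 1.4.5 p. 44, §2.4.1 Prop. 2.4.2 (a) p. 114]
[cite: MumfordAV1970, §20 property (3) p. 186 and §23 p. 208] -/
theorem weilDiv_map_linEquiv_pullback_weilDiv_of_form_adjoint' (e e' : A ⟶ A) [IsDominant e.hom.hom.hom.left]
    {M M' : Matrix ι ι ℤ} {F F' : (Fin A.dim → ℂ) →L[ℂ] (Fin A.dim → ℂ)}
    (hF : ∀ x, Φ ((M.map (Int.cast : ℤ → ℝ)) *ᵥ x) = F (Φ x))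
    (hF' : ∀ x, Φ ((M'.map (Int.cast : ℤ → ℝ)) *ᵥ x) = F' (Φ x))
    (hM : ∀ t, φ (mapMatrix Φ Φ M t) = AlgPoints.map e.hom.hom.hom (φ t))
    (hM' : ∀ t, φ (mapMatrix Φ Φ M' t) = AlgPoints.map e'.hom.hom.hom (φ t))
    (Θ : CartierDivisor A.X.left) (p : AHData Φ) (hp : AHData.toPic p = picClass (cartierDivisorLineBundle hφ Θ))
    (hadj : ∀ u w : Fin A.dim → ℂ, p.form ![F' u, w] = p.form ![u, F w]) (t : ComplexTorus Φ) :
    (A.weilDiv Θ (AlgPoints.map e'.hom.hom.hom (φ t))).LinEquiv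
      ((A.weilDiv Θ (φ t)).pullback e.hom.hom.hom.left) := by
  refine A.linEquiv_of_picClass_eq hφ ?_
  -- the class of `D_{e′(φ t̄)}` is `φ_L(M′ t̄)`
  rw [← hM', picClass_cartierDivisorLineBundle_weilDiv A hφ hadd Θ (mapMatrix Φ Φ M' t),
    -- the class of `e^* D_{φ t̄}` is `(M·)^* φ_L(t̄)`
    picClass_cartierDivisorLineBundle_pullback_hom hφ hφ e M hF hM (A.weilDiv Θ (φ t)),
    picClass_cartierDivisorLineBundle_weilDiv A hφ hadd Θ t, ← hp]
  -- [Lange 2023] Exercise 2.4.5 (12)(d) at `f₂ = 1_X`: `φ_L(M′ t̄) = (M·)^* φ_L(t̄)`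
  exact phiL_toPic_mapMatrix_eq_pullback_phiL_of_form_adjoint Φ hF hF' p hadj t

/-- **`D^Θ_{e′ x} ∼ e^* D^Θ_x` for EVERY complex point `x` of `A`, for `E`-adjoint endomorphisms `e, e′`** — the divisor-level Rosati identity
`φ_Θ(e′x) = e^*φ_Θ(x)` ([MumfordAV1970] §20 (3), §23; [Lange2023AbelianVarietiesComplex] Prop. 2.4.2 (a), Lemma 1.4.5): same data as the primed
form; `x = φ(t̄)` for `t̄ = φ⁻¹ x` since `φ` is a bijection.
[cite: Lange2023AbelianVarietiesComplex, §2.4.1 Prop. 2.4.2 (a) p. 114, §1.4.2 Lemma 1.4.5 p. 44, §2.4.5 Exercise (12)(d) p. 126]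
[cite: MumfordAV1970, §20 property (3) p. 186 and §23 p. 208] -/
theorem weilDiv_map_linEquiv_pullback_weilDiv_of_form_adjoint (e e' : A ⟶ A) [IsDominant e.hom.hom.hom.left]
    {M M' : Matrix ι ι ℤ} {F F' : (Fin A.dim → ℂ) →L[ℂ] (Fin A.dim → ℂ)}
    (hF : ∀ x, Φ ((M.map (Int.cast : ℤ → ℝ)) *ᵥ x) = F (Φ x))
    (hF' : ∀ x, Φ ((M'.map (Int.cast : ℤ → ℝ)) *ᵥ x) = F' (Φ x))
    (hM : ∀ t, φ (mapMatrix Φ Φ M t) = AlgPoints.map e.hom.hom.hom (φ t))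
    (hM' : ∀ t, φ (mapMatrix Φ Φ M' t) = AlgPoints.map e'.hom.hom.hom (φ t))
    (Θ : CartierDivisor A.X.left) (p : AHData Φ) (hp : AHData.toPic p = picClass (cartierDivisorLineBundle hφ Θ))
    (hadj : ∀ u w : Fin A.dim → ℂ, p.form ![F' u, w] = p.form ![u, F w]) (x : A.Points ℂ) :
    (A.weilDiv Θ (AlgPoints.map e'.hom.hom.hom x)).LinEquiv ((A.weilDiv Θ x).pullback e.hom.hom.hom.left) := by
  have hx : φ (hφ.homeomorph.symm x) = x := hφ.homeomorph.apply_symm_apply x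
  rw [← hx]
  exact weilDiv_map_linEquiv_pullback_weilDiv_of_form_adjoint' hφ hadd e e' hF hF' hM hM' Θ p hp hadj _

omit hadd in
/-- **An Appell–Humbert datum of `[𝒪(Θ)^an]` exists** ([Lange2023AbelianVarietiesComplex] §1.3.2 Thm. 1.3.3: every class in `Pic(X)` is
`⟦a_{(H, χ)}⟧`; ★ `AHData.toPic_surjective`) — the `p` of the two theorems above is never an extra assumption.
[cite: Lange2023AbelianVarietiesComplex, §1.3.2 Thm. 1.3.3 p. 30] -/
theorem exists_ahData_toPic_eq_picClass_cartierDivisorLineBundle (Θ : CartierDivisor A.X.left) :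
    ∃ p : AHData Φ, AHData.toPic p = picClass (cartierDivisorLineBundle hφ Θ) :=
  AHData.toPic_surjective _

end Literature.AlgebraicGeometry.HodgeTheory

end
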